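import Literature.NumberTheory.Automorphic.LieAlgebraGLUnipotentLog
import Literature.NumberTheory.Automorphic.LieAlgebraGLNilpotentExp
import Literature.NumberTheory.Automorphic.ZariskiGL
import HarnessLib

/-!
# Block-diagonal algebraic subgroups of `GL(⊕ᵢ kᵐⁱ)`: blocks, block projections, and the Lie algebra
(Katz 1990, proof of Prop. 1.8.2 "`G° maps onto each Gᵢ°`, … `Lie(G) ⊆ Π Lie(Gᵢ)`"; Springer 2.4.8, 4.4.9)

Companion to `ZariskiGL.lean`, `LieAlgebraGL.lean`, `JordanDecompositionAlgGroup.lean`,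
`LieAlgebraGLUnipotentLog.lean`, `LieAlgebraGLNilpotentExp.lean` (namespace `Literature.NumberTheory.Automorphic`,
concrete `k`-points vocabulary). The index type is a dependent sum `Σ i, m i` over a finite `ι`, matrices
are cut into blocks by Mathlib's `Matrix.blockDiagonal'` / `Matrix.blockDiag'`, and a matrix is BLOCK
DIAGONAL when its off-diagonal blocks vanish (`∀ a b, a.1 ≠ b.1 → M a b = 0`). All proved:

* §1 `det_blockDiagonal'` (`det (⊕ dᵢ) = ∏ det dᵢ`, unequal block sizes), block-diagonal matrices are
  `blockDiagonal'` of their blocks, blocks of products / inverses of block-diagonal matrices, invertibility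
  of the blocks of an invertible block-diagonal matrix.
* §2 `offDiag_eq_zero_of_mem_zariskiClosure` — the Zariski closure of a group of block-diagonal matrices is
  block diagonal (the off-diagonal coordinates vanish on a closed set); `offDiag_eq_zero_of_mem_lieAlgebraGL`
  — so is the Lie algebra of a block-diagonal group (Katz: `Lie(G) ⊆ Π Lie(Gᵢ)`).
* §3 **`exists_mem_lieAlgebraGL_blockDiag_eq_sub_one`** — for `L` algebraic and block diagonal
  (`k` algebraically closed of characteristic `0`): if a unipotent block `u` with `(u−1)² = 0` is the `i`-th
  block of an element of `L`, then `u − 1` is the `i`-th block of an element of `Lie(L)`.  Proof: the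
  `i`-th block projection `L → GL(mᵢ)` is an algebraic homomorphism, so it carries the Jordan decomposition
  `g = g_s g_u` inside `L` (Springer 2.4.8, `exists_isJordanDecomp_mem`, `IsJordanDecomp.map_of_isAlgebraicGL`)
  to that of `u`, which is `(1, u)`: the `i`-th block of `g_u` is `u`; and `log g_u ∈ Lie(L)`
  (`log_mem_lieAlgebraGL`) has `i`-th block `log u = u − 1`.  This is the step "`Lie(Gᵢ^{0,der}) ⊆ pᵢ Lie(G°)`"
  of Katz's proof for transvection generators, WITHOUT the differential-of-a-morphism / dimension theory.
* §4 `exists_mem_coe_eq_one_add_blockDiagonal_single` — conversely a square-zero block `E` placed at `i`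
  inside `Lie(L)` exponentiates to the element `1 + (0,…,E,…,0)` of `L` (`expHom_mem_of_mem_lieAlgebraGL`).

Consumer: the Goursat–Kolchin–Ribet core (`Literature/AlgebraicGeometry/HodgeTheory/GoursatKolchinRibet*`,
crux K1 of `Summits/HodgeConjecture/HodgeConjecture/Theses/CyclicUnitaryPowers.lean`, cell `hodge-nonav`).
Written by the prover seat `hodge-nonav-prover-Ax`.

## Mathlib

`Matrix.blockDiagonal'` (+ `RingHom`, `_mul`, `_pow`, `_smul`, `_injective`), `Matrix.blockDiag'`,
`Matrix.BlockTriangular.det_fintype`, `Matrix.GeneralLinearGroup.mkOfDetNeZero`, `IsNilpotent.exp_eq_sum`,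
`Pi.single_mul`. Mathlib has `Matrix.det_blockDiagonal` (equal blocks) but not the `Σ`-type version (a private
copy exists in `Literature/AlgebraicGeometry/HodgeTheory/WeilClassesFieldDecomposableOfMatrixBlocks`, made
public here).

## References

* [Katz1990ESDE] N. M. Katz, *Exponential Sums and Differential Equations* (1990), §1.8, proof of Prop. 1.8.2.
* [SpringerLAG1998] T. A. Springer, *Linear Algebraic Groups*, 2nd ed. (1998), 2.2.4, 2.4.8, 4.4.9.
* [Borel1991] A. Borel, *Linear Algebraic Groups*, 2nd ed. (1991), I.2.1, II.7.3.
-/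

open scoped MatrixGroups

namespace Literature.NumberTheory.Automorphic

open Matrix

variable {k : Type*} [Field k] {ι : Type*} [Fintype ι] [DecidableEq ι] {m : ι → Type*}
  [∀ i, Fintype (m i)] [∀ i, DecidableEq (m i)]

/-! ### §1 Block-diagonal matrices -/

section Blocks

/-- **`det (blockDiagonal' d) = ∏ᵢ det dᵢ`** for square blocks of (possibly) different sizes, via block
triangularity along an enumeration of the block index (Mathlib's `Matrix.det_blockDiagonal` is the
equal-size case). [cite: Katz1990ESDE, §1.8 Prop. 1.8.2 (proof)] -/
theorem det_blockDiagonal' (d : ∀ i, Matrix (m i) (m i) k) : (blockDiagonal' d).det = ∏ i, (d i).det := by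
  -- adapted from Literature/AlgebraicGeometry/HodgeTheory/WeilClassesFieldDecomposableOfMatrixBlocks (private there)
  let e := Fintype.equivFin ι
  have hT : (blockDiagonal' d).BlockTriangular (fun a : Σ j, m j => e a.1) := by
    rintro ⟨i, x⟩ ⟨j, y⟩ h
    exact blockDiagonal'_apply_ne d x y fun hij => absurd (congrArg (⇑e) hij.symm) (ne_of_lt h)
  rw [hT.det_fintype]
  refine (Fintype.prod_equiv e (fun i => (d i).det) _ fun i => ?_).symm
  let f₀ : m i ≃ {a : Σ j, m j // a.1 = i} :=
    { toFun := fun x => ⟨⟨i, x⟩, rfl⟩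
      invFun := fun a => a.2 ▸ a.1.2
      left_inv := fun _ => rfl
      right_inv := by
        rintro ⟨⟨j, x⟩, h⟩
        subst h
        rfl }
  let f : m i ≃ {a : Σ j, m j // e a.1 = e i} := f₀.trans (Equiv.subtypeEquivRight fun a => e.injective.eq_iff.symm)
  rw [toSquareBlock_def, ← det_submatrix_equiv_self f]
  congr 1
  ext x y
  simp only [submatrix_apply]
  exact (blockDiagonal'_apply_eq d i x y).symm

omit [Fintype ι] [∀ i, Fintype (m i)] [∀ i, DecidableEq (m i)] in
/-- A matrix with vanishing off-diagonal blocks is the block-diagonal matrix of its diagonal blocks.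
[cite: Katz1990ESDE, §1.8 Prop. 1.8.2 (proof)] -/
theorem blockDiagonal'_blockDiag'_of_offDiag {M : Matrix (Σ i, m i) (Σ i, m i) k}
    (hM : ∀ a b : Σ i, m i, a.1 ≠ b.1 → M a b = 0) : blockDiagonal' (fun i => blockDiag' M i) = M := by
  ext ⟨i, a⟩ ⟨j, b⟩
  by_cases hij : i = j
  · subst hij
    rw [blockDiagonal'_apply_eq, blockDiag'_apply]
  · rw [blockDiagonal'_apply_ne _ _ _ hij, hM _ _ hij]

omit [DecidableEq ι] [∀ i, DecidableEq (m i)] in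
/-- **Blocks of a product, block-diagonal left factor**: `(M N)ᵢ = Mᵢ Nᵢ`. [cite: Katz1990ESDE, §1.8 Prop. 1.8.2 (proof)] -/
theorem blockDiag'_mul_of_offDiag {M : Matrix (Σ i, m i) (Σ i, m i) k}
    (hM : ∀ a b : Σ i, m i, a.1 ≠ b.1 → M a b = 0) (N : Matrix (Σ i, m i) (Σ i, m i) k) (i : ι) :
    blockDiag' (M * N) i = blockDiag' M i * blockDiag' N i := by
  classical
  ext a b
  simp only [blockDiag'_apply, Matrix.mul_apply]
  rw [← Finset.univ_sigma_univ, Finset.sum_sigma, Finset.sum_eq_single i]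
  · intro j _ hji
    exact Finset.sum_eq_zero fun c _ => by rw [hM ⟨i, a⟩ ⟨j, c⟩ (Ne.symm hji), zero_mul]
  · intro h
    exact absurd (Finset.mem_univ i) h

omit [DecidableEq ι] [∀ i, DecidableEq (m i)] in
/-- Blocks of a product, block-diagonal right factor: `(M N)ᵢ = Mᵢ Nᵢ`. [cite: Katz1990ESDE, §1.8 Prop. 1.8.2 (proof)] -/
theorem blockDiag'_mul_of_offDiag_right (M : Matrix (Σ i, m i) (Σ i, m i) k) {N : Matrix (Σ i, m i) (Σ i, m i) k}
    (hN : ∀ a b : Σ i, m i, a.1 ≠ b.1 → N a b = 0) (i : ι) :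
    blockDiag' (M * N) i = blockDiag' M i * blockDiag' N i := by
  classical
  ext a b
  simp only [blockDiag'_apply, Matrix.mul_apply]
  rw [← Finset.univ_sigma_univ, Finset.sum_sigma, Finset.sum_eq_single i]
  · intro j _ hji
    exact Finset.sum_eq_zero fun c _ => by rw [hN ⟨j, c⟩ ⟨i, b⟩ hji, mul_zero]
  · intro h
    exact absurd (Finset.mem_univ i) h

omit [DecidableEq ι] [∀ i, DecidableEq (m i)] in
/-- Products of block-diagonal matrices are block diagonal. [cite: Katz1990ESDE, §1.8 Prop. 1.8.2 (proof)] -/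
theorem offDiag_mul_eq_zero {M N : Matrix (Σ i, m i) (Σ i, m i) k}
    (hM : ∀ a b : Σ i, m i, a.1 ≠ b.1 → M a b = 0) (hN : ∀ a b : Σ i, m i, a.1 ≠ b.1 → N a b = 0) :
    ∀ a b : Σ i, m i, a.1 ≠ b.1 → (M * N) a b = 0 := by
  intro a b hab
  rw [Matrix.mul_apply]
  refine Finset.sum_eq_zero fun c _ => ?_
  by_cases hac : a.1 = c.1
  · rw [hN c b (hac ▸ hab), mul_zero]
  · rw [hM a c hac, zero_mul]

omit [Fintype ι] [∀ i, Fintype (m i)] [∀ i, DecidableEq (m i)] in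
/-- `blockDiagonal'` matrices are block diagonal. [cite: Katz1990ESDE, §1.8 Prop. 1.8.2 (proof)] -/
theorem offDiag_blockDiagonal' (w : ∀ i, Matrix (m i) (m i) k) :
    ∀ a b : Σ i, m i, a.1 ≠ b.1 → blockDiagonal' w a b = 0 :=
  fun a b hab => blockDiagonal'_apply_ne w a.2 b.2 hab

omit [Fintype ι] [DecidableEq ι] [∀ i, Fintype (m i)] [∀ i, DecidableEq (m i)] in
/-- Blocks of a linear combination. [cite: Katz1990ESDE, §1.8 Prop. 1.8.2 (proof)] -/
theorem blockDiag'_sum_smul {s : Finset ℕ} (c : ℕ → k) (M : ℕ → Matrix (Σ i, m i) (Σ i, m i) k) (i : ι) :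
    blockDiag' (∑ j ∈ s, c j • M j) i = ∑ j ∈ s, c j • blockDiag' (M j) i := by
  change blockDiag'AddMonoidHom m m k (∑ j ∈ s, c j • M j) i = _
  rw [map_sum, Finset.sum_apply]
  refine Finset.sum_congr rfl fun j _ => ?_
  change blockDiag' (c j • M j) i = _
  rw [blockDiag'_smul]
  rfl

/-- **The blocks of an invertible block-diagonal matrix are invertible** (`det g = ∏ det gᵢ ≠ 0`).
[cite: Katz1990ESDE, §1.8 Prop. 1.8.2 (proof)] -/
theorem det_blockDiag'_ne_zero {g : GL (Σ i, m i) k}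
    (hg : ∀ a b : Σ i, m i, a.1 ≠ b.1 → (g : Matrix (Σ i, m i) (Σ i, m i) k) a b = 0) (i : ι) :
    (blockDiag' (g : Matrix (Σ i, m i) (Σ i, m i) k) i).det ≠ 0 := by
  have h := Matrix.GeneralLinearGroup.det_ne_zero g
  rw [← blockDiagonal'_blockDiag'_of_offDiag hg, det_blockDiagonal', Finset.prod_ne_zero_iff] at h
  exact h i (Finset.mem_univ i)

/-- **Blocks of the inverse of a block-diagonal invertible matrix**: `(g⁻¹)ᵢ = (gᵢ)⁻¹`.
[cite: Katz1990ESDE, §1.8 Prop. 1.8.2 (proof)] -/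
theorem blockDiag'_coe_inv {g : GL (Σ i, m i) k}
    (hg : ∀ a b : Σ i, m i, a.1 ≠ b.1 → (g : Matrix (Σ i, m i) (Σ i, m i) k) a b = 0) (i : ι) :
    blockDiag' ((g⁻¹ : GL (Σ i, m i) k) : Matrix (Σ i, m i) (Σ i, m i) k) i =
      (blockDiag' (g : Matrix (Σ i, m i) (Σ i, m i) k) i)⁻¹ := by
  symm
  apply Matrix.inv_eq_right_inv
  rw [← blockDiag'_mul_of_offDiag hg, ← Units.val_mul, mul_inv_cancel, Units.val_one, blockDiag'_one]
  rfl

end Blocks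

/-! ### §2 Closures and Lie algebras of block-diagonal groups are block diagonal -/

section Closure

/-- **The Zariski closure of a group of block-diagonal matrices is block diagonal**: the off-diagonal
coordinates vanish on `Δ`, hence on its closure (Borel I.2.1; Katz: the closure of `H ≤ Π GL(Vᵢ)` lies in
`Π GL(Vᵢ)`). [cite: Katz1990ESDE, §1.8 Prop. 1.8.2 (proof)] [cite: Borel1991, I.2.1] -/
theorem offDiag_eq_zero_of_mem_zariskiClosure {Δ : Subgroup (GL (Σ i, m i) k)}
    (hΔ : ∀ g ∈ Δ, ∀ a b : Σ i, m i, a.1 ≠ b.1 → (g : Matrix (Σ i, m i) (Σ i, m i) k) a b = 0)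
    {g : GL (Σ i, m i) k} (hg : g ∈ zariskiClosure Δ) :
    ∀ a b : Σ i, m i, a.1 ≠ b.1 → (g : Matrix (Σ i, m i) (Σ i, m i) k) a b = 0 := by
  letI := zariskiTopologyGL (Σ i, m i) k
  set S : Set (MvPolynomial (GLCoord (Σ i, m i)) k) :=
    Set.range fun ab : {ab : (Σ i, m i) × (Σ i, m i) // ab.1.1 ≠ ab.2.1} => MvPolynomial.X (Sum.inl ab.1) with hS
  have hZ : ((Δ : Subgroup (GL (Σ i, m i) k)) : Set (GL (Σ i, m i) k)) ⊆ zeroLocusGL S := by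
    rintro x hx p ⟨⟨⟨a, b⟩, hab⟩, rfl⟩
    rw [MvPolynomial.eval_X, glCoordFun_inl]
    exact hΔ x hx a b hab
  have hg' := closure_minimal hZ (isClosed_zeroLocusGL S) (mem_zariskiClosure_iff.1 hg)
  intro a b hab
  have h := hg' (MvPolynomial.X (Sum.inl (a, b))) ⟨⟨(a, b), hab⟩, rfl⟩
  rwa [MvPolynomial.eval_X, glCoordFun_inl] at h

/-- **The Lie algebra of a block-diagonal group is block diagonal** (Katz: `Lie(G) ⊆ Π Lie(Gᵢ)`): the
off-diagonal coordinate `x_{ab}` lies in the vanishing ideal of `L`, and its differential at `1` along `X`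
is `X_{ab}`. [cite: Katz1990ESDE, §1.8 Prop. 1.8.2 (proof)] -/
theorem offDiag_eq_zero_of_mem_lieAlgebraGL {L : Subgroup (GL (Σ i, m i) k)}
    (hL : ∀ g ∈ L, ∀ a b : Σ i, m i, a.1 ≠ b.1 → (g : Matrix (Σ i, m i) (Σ i, m i) k) a b = 0)
    {X : Matrix (Σ i, m i) (Σ i, m i) k} (hX : X ∈ lieAlgebraGL L) :
    ∀ a b : Σ i, m i, a.1 ≠ b.1 → X a b = 0 := by
  intro a b hab
  rw [mem_lieAlgebraGL_iff] at hX
  have hp : MvPolynomial.X (Sum.inl (a, b)) ∈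
      MvPolynomial.vanishingIdeal k (glCoordFun '' ((L : Subgroup (GL (Σ i, m i) k)) : Set (GL (Σ i, m i) k))) := by
    rw [mem_vanishingIdeal_glCoordFun_iff]
    intro g hg
    rw [MvPolynomial.eval_X, glCoordFun_inl]
    exact hL g hg a b hab
  have h := hX _ hp
  rwa [tangentDeriv_X] at h

end Closure

/-! ### §3 The block projection carries the Jordan decomposition; logarithms of lifted transvections -/

section Projection

variable {L : Subgroup (GL (Σ i, m i) k)}

/-- **The `i`-th block projection of a block-diagonal algebraic group is an algebraic homomorphism, so a
unipotent block of an element of `L` is the block of a unipotent element of `L` whose logarithm lies in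
`Lie(L)`** — packaged as: if `u` with `(u − 1)² = 0` is the `i`-th block of some `g ∈ L` (`L` algebraic,
block diagonal, `k` algebraically closed of characteristic `0`, `|mᵢ| ≥ 2`), then `u − 1` is the `i`-th
block of some `X ∈ lieAlgebraGL L`.  (Katz, proof of 1.8.2: `G°` maps onto `Gᵢ°`, and then
`dρᵢ(Lie G) = Lie Gᵢ ⊇ Lie(Gᵢ^{0,der})`; here for the generators `u − 1 = E_{ab}` via Springer 2.4.8 (Jordan
decomposition in `L` and under the morphism `ρᵢ`) and the logarithm `log g_u ∈ Lie(L)`.)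
[cite: Katz1990ESDE, §1.8 Prop. 1.8.2 (proof)] [cite: SpringerLAG1998, 2.4.8] -/
theorem exists_mem_lieAlgebraGL_blockDiag_eq_sub_one [IsAlgClosed k] [CharZero k] (hLalg : IsAlgebraicSubgroup L)
    (hL : ∀ g ∈ L, ∀ a b : Σ i, m i, a.1 ≠ b.1 → (g : Matrix (Σ i, m i) (Σ i, m i) k) a b = 0)
    (i : ι) (hi : 2 ≤ Fintype.card (m i)) {u : Matrix (m i) (m i) k} (hu : (u - 1) * (u - 1) = 0)
    (hlift : ∃ g ∈ L, blockDiag' (g : Matrix (Σ i, m i) (Σ i, m i) k) i = u) :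
    ∃ X ∈ lieAlgebraGL L, blockDiag' X i = u - 1 := by
  classical
  -- the `i`-th block projection `φ : L → GL(mᵢ)`
  have hdet : ∀ g : ↥L, (blockDiag' ((g : GL (Σ i, m i) k) : Matrix (Σ i, m i) (Σ i, m i) k) i).det ≠ 0 :=
    fun g => det_blockDiag'_ne_zero (hL g g.2) i
  let φ : ↥L →* GL (m i) k :=
    { toFun := fun g => Matrix.GeneralLinearGroup.mkOfDetNeZero _ (hdet g)
      map_one' := by
        apply Units.ext
        change blockDiag' ((1 : GL (Σ i, m i) k) : Matrix (Σ i, m i) (Σ i, m i) k) i = 1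
        rw [Units.val_one, blockDiag'_one]
        rfl
      map_mul' := fun g h => by
        apply Units.ext
        change blockDiag' (((g : GL (Σ i, m i) k) * (h : GL (Σ i, m i) k) : GL (Σ i, m i) k) :
            Matrix (Σ i, m i) (Σ i, m i) k) i =
          blockDiag' ((g : GL (Σ i, m i) k) : Matrix (Σ i, m i) (Σ i, m i) k) i *
            blockDiag' ((h : GL (Σ i, m i) k) : Matrix (Σ i, m i) (Σ i, m i) k) i
        rw [Units.val_mul, blockDiag'_mul_of_offDiag (hL g g.2)] }
  have hφval : ∀ g : ↥L, ((φ g : GL (m i) k) : Matrix (m i) (m i) k) =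
      blockDiag' ((g : GL (Σ i, m i) k) : Matrix (Σ i, m i) (Σ i, m i) k) i := fun g => rfl
  -- `φ` is algebraic: entries are coordinates, `det⁻¹` of the block is `det⁻¹ · ∏_{j ≠ i} det(block j)`
  have hφ : MonoidHom.IsAlgebraicGL φ := by
    refine ⟨Sum.elim (fun ab => MvPolynomial.X (Sum.inl (⟨i, ab.1⟩, ⟨i, ab.2⟩)))
      (fun _ => MvPolynomial.X (Sum.inr ()) *
        ∏ j ∈ Finset.univ.erase i, (Matrix.of fun a b : m j =>
          (MvPolynomial.X (Sum.inl (⟨j, a⟩, ⟨j, b⟩)) : MvPolynomial (GLCoord (Σ i, m i)) k)).det), fun g c => ?_⟩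
    rcases c with ⟨a, b⟩ | u'
    · rw [glCoordFun_inl, hφval, Sum.elim_inl, MvPolynomial.eval_X, glCoordFun_inl, blockDiag'_apply]
    · have hblk : ∀ j, MvPolynomial.eval (glCoordFun (g : GL (Σ i, m i) k))
          (Matrix.of fun a b : m j => (MvPolynomial.X (Sum.inl (⟨j, a⟩, ⟨j, b⟩)) :
            MvPolynomial (GLCoord (Σ i, m i)) k)).det =
          (blockDiag' ((g : GL (Σ i, m i) k) : Matrix (Σ i, m i) (Σ i, m i) k) j).det := by
        intro j
        rw [RingHom.map_det]
        congr 1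
        ext a b
        rw [RingHom.mapMatrix_apply, Matrix.map_apply, Matrix.of_apply, MvPolynomial.eval_X, glCoordFun_inl,
          blockDiag'_apply]
      have hdetg : ((g : GL (Σ i, m i) k) : Matrix (Σ i, m i) (Σ i, m i) k).det =
          ∏ j, (blockDiag' ((g : GL (Σ i, m i) k) : Matrix (Σ i, m i) (Σ i, m i) k) j).det := by
        conv_lhs => rw [← blockDiagonal'_blockDiag'_of_offDiag (hL g g.2)]
        rw [det_blockDiagonal']
      have hne : ∏ j ∈ Finset.univ.erase i,
          (blockDiag' ((g : GL (Σ i, m i) k) : Matrix (Σ i, m i) (Σ i, m i) k) j).det ≠ 0 :=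
        Finset.prod_ne_zero_iff.2 fun j _ => det_blockDiag'_ne_zero (hL g g.2) j
      rw [glCoordFun_inr, hφval, Sum.elim_inr, map_mul, MvPolynomial.eval_X, glCoordFun_inr, map_prod]
      simp_rw [hblk]
      rw [hdetg, ← Finset.mul_prod_erase _ _ (Finset.mem_univ i), mul_inv, mul_assoc, inv_mul_cancel₀ hne, mul_one]
  -- lift `u`, split `g = g_s g_u` inside `L`, project
  obtain ⟨g, hgL, hgu⟩ := hlift
  obtain ⟨s, hsL, v, hvL, hJ⟩ := exists_isJordanDecomp_mem hLalg hgL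
  have hJ' := hJ.map_of_isAlgebraicGL hLalg hφ hgL
  have hunip : IsUnipotentElt (φ ⟨g, hgL⟩) := by
    refine ⟨2, ?_⟩
    rw [hφval]
    change (blockDiag' ((g : GL (Σ i, m i) k) : Matrix (Σ i, m i) (Σ i, m i) k) i - 1) ^ 2 = 0
    rw [hgu, pow_two, hu]
  have hss1 : IsSemisimpleElt (1 : GL (m i) k) := by
    change Module.End.IsSemisimple (Matrix.toLin' ((1 : GL (m i) k) : Matrix (m i) (m i) k))
    rw [Units.val_one, Matrix.toLin'_one]
    exact Module.End.isSemisimple_id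
  have hJ1 : IsJordanDecomp (φ ⟨g, hgL⟩) 1 (φ ⟨g, hgL⟩) := ⟨hss1, hunip, one_mul _, Commute.one_left _⟩
  obtain ⟨-, hv⟩ := hJ1.unique hJ'
  -- `φ v = u`
  have hvi : blockDiag' ((v : GL (Σ i, m i) k) : Matrix (Σ i, m i) (Σ i, m i) k) i = u := by
    have h := congrArg (fun x : GL (m i) k => (x : Matrix (m i) (m i) k)) hv
    simp only [hφval] at h
    rw [← h, hgu]
  -- `log v ∈ Lie(L)` and its `i`-th block is `log u = u - 1`
  refine ⟨_, log_mem_lieAlgebraGL hLalg hJ.unipotent hvL, ?_⟩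
  have hv1 : ((v : GL (Σ i, m i) k) : Matrix (Σ i, m i) (Σ i, m i) k) - 1 =
      blockDiagonal' fun j => blockDiag' ((v : GL (Σ i, m i) k) : Matrix (Σ i, m i) (Σ i, m i) k) j - 1 := by
    change _ = blockDiagonal' ((fun j => blockDiag' ((v : GL (Σ i, m i) k) : Matrix (Σ i, m i) (Σ i, m i) k) j) - 1)
    rw [blockDiagonal'_sub, blockDiagonal'_blockDiag'_of_offDiag (hL v hvL), blockDiagonal'_one]
  rw [blockDiag'_sum_smul]
  simp_rw [hv1, ← blockDiagonal'_pow, blockDiag'_blockDiagonal', Pi.pow_apply, hvi]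
  refine sum_coeff_choosePoly_smul_pow_eq_self (le_trans hi ?_) hu
  rw [Fintype.card_sigma]
  exact Finset.single_le_sum (f := fun j => Fintype.card (m j)) (fun j _ => Nat.zero_le _) (Finset.mem_univ i)

end Projection

/-! ### §4 Exponentials of single nilpotent blocks -/

section Exp

/-- **A square-zero block `E` at place `i` inside `Lie(L)` exponentiates into `L`**: if
`(0,…,E,…,0) ∈ lieAlgebraGL L` with `E² = 0` (`L` algebraic, characteristic `0`), then the block-diagonal
unipotent `1 + (0,…,E,…,0) = exp (0,…,E,…,0)` lies in `L` (`expHom_mem_of_mem_lieAlgebraGL`).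
[cite: Borel1991, II.7.3] [cite: Katz1990ESDE, §1.8 Prop. 1.8.2 (proof)] -/
theorem exists_mem_coe_eq_one_add_blockDiagonal_single [CharZero k] {L : Subgroup (GL (Σ i, m i) k)}
    (hLalg : IsAlgebraicSubgroup L) (i : ι) {E : Matrix (m i) (m i) k} (hE : E * E = 0)
    (hmem : blockDiagonal' (Pi.single (M := fun j => Matrix (m j) (m j) k) i E) ∈ lieAlgebraGL L) :
    ∃ g ∈ L, (g : Matrix (Σ i, m i) (Σ i, m i) k) =
      1 + blockDiagonal' (Pi.single (M := fun j => Matrix (m j) (m j) k) i E) := by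
  have hsq : blockDiagonal' (Pi.single (M := fun j => Matrix (m j) (m j) k) i E) ^ 2 = 0 := by
    rw [pow_two, ← blockDiagonal'_mul]
    change blockDiagonal' (Pi.single (M := fun j => Matrix (m j) (m j) k) i E *
      Pi.single (M := fun j => Matrix (m j) (m j) k) i E) = 0
    rw [← Pi.single_mul, hE, Pi.single_zero, blockDiagonal'_zero]
  have hnil : IsNilpotent (blockDiagonal' (Pi.single (M := fun j => Matrix (m j) (m j) k) i E)) := ⟨2, hsq⟩
  refine ⟨expHom _ hnil (Multiplicative.ofAdd 1), expHom_mem_of_mem_lieAlgebraGL hLalg hmem hnil _, ?_⟩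
  rw [coe_expHom_apply, toAdd_ofAdd, one_smul, IsNilpotent.exp_eq_sum hsq, Finset.sum_range_succ,
    Finset.sum_range_succ, Finset.sum_range_zero, zero_add, pow_zero, pow_one, Nat.factorial_zero,
    Nat.factorial_one, Nat.cast_one, inv_one, one_smul, one_smul]

end Exp

end Literature.NumberTheory.Automorphic
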